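import Mathlib
import Literature.NumberTheory.EllipticCurves.Smith2016.CongruentNumberGenusDeterminantRowSixForest
import Literature.NumberTheory.EllipticCurves.Smith2016.CongruentNumberGenusSumSixDecompositions

/-!
# Smith 2016, Theorem 2.2 row 6 (every `k`): the forest sum of `det M₆` evaluated in genus class numbers

Continuation of `CongruentNumberGenusDeterminantRowSixForest` [Smith2016CongruentDensity, Table 2 row 6 and
§2.2, source `cnc2.tex` l. 73–110].  There: `det M₆ ≙ (t;t)ᵀ adj(M₂) (t;t) = Σ_B (Σ_B t) q_t(A^B) · e₂([k]∖B)`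
with `e₂ = setExp (fwt a t z z)` (Smith's `det M₂[S′]` in forest form) and `(Σ_B t) q_t(A^B) = [d_B ≡ 3 (4)] g(d_B)`.
Here, for `n = 2p₁⋯p_k ≡ 6 (mod 8)` (i.e. `∏ pᵢ ≡ 3 (mod 4)`), the remaining factors are evaluated:

* `setExp_fwt_mark_block_eq` — for a block `R` with `Σ_R t = 0`:
  `e₂(R) = Σ_{T ⊆ R} [d_T ≡ 1 (4)] g(2 d_T) · ℒ(d_{R∖T})`, `ℒ(m) = Σ_{D ∈ decompositions m} ∏_{d∈D} [d ≡ 1 (8)] g(d)`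
  (Smith's `det M₂ = Σ_S det P[S] det M₁[S′]` on the sub-block: the forest formula, `setExp_add`, the lemma
  `det P[T] = g(2d_T)` for `Σ_T t = 0` of `CongruentNumberGenusDeterminantEvenBlocks`, and `ℒ(d) = 0` for
  `d ≢ 1 (8)`);
* `pointedMark_eq_sum_genusWeight_two` — **the `d ≡ 3 (8)` part is a pure even sum**:
  `Σ_B (Σ_B t) q_z(A^B) · e₂([k]∖B) = Σ_{S : d_S ≡ 3 (4)} g(2 d_S) · ℒ(d_{[k]∖S})` (swap to `S = B ∪ T`,
  Smith's lemma on `T = S ∖ B`, and the pointing identity `Σ_{B ⊆ S} (Σ_B t) q_z(B) setExp(q_z)(S∖B) =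
  (Σ_S t) setExp(q_z)(S) = det(A^S + D_z) = g(2d_S)` — Smith's "`|T| = |A + D_z, z; yᵀ, 0|` is nonzero iff
  `det(A + D_z) ≠ 0`", cnc2.tex l. 100–107);
* `border_adjugate_six_eq_sum_genusWeight` — **`det M₆` in genus class numbers, every `k`**:
  `(t;t)ᵀ adj(M₂) (t;t) = Σ_{S : d_S ≡ 3 (4)} g(2d_S) ℒ(d_{[k]∖S}) + Σ_{B : d_B ≡ 7 (8)} g(d_B) Σ_{T ⊆ [k]∖B, d_T ≡ 1 (4)} g(2d_T) ℒ(d_{[k]∖B∖T})`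
  — Smith's `ℒ₆(n) = Σ_{d | n, d ≡ n (16)} g(d)ℒ(n/d) + Σ_{d₀d₁ | n, d₀ ≡ 7n (16), d₁ ≡ 7 (8)} g(d₀)g(d₁)ℒ(n/d₀d₁)`
  with the blocks written as index sets (`2d_S` even with `d_S ≡ 3 (4)`; `d_B ≡ 7 (8)` and `2d_T` even).
The identification with Tian–Yuan–Zhang's second genus sum `Σ₂'(n)` and the `2`-Selmer consequence are in
`CongruentNumberGenusDeterminantRowSix`.
-/

namespace Literature.NumberTheory.EllipticCurves.Smith2016

open _root_.Matrix Finset Literature.LinearAlgebra.Matrix Literature.Combinatorics.Enumerative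
open Literature.NumberTheory.EllipticCurves.HeathBrown1994
open Literature.NumberTheory.EllipticCurves.TianYuanZhang2017
open Literature.NumberTheory.EllipticCurves.HeathBrown1994.Families (legendreMatrix_apply_of_ne legendreMatrix_apply_self)
open Literature.NumberTheory.EllipticCurves.MonskySelmerParity

variable {k : ℕ} (p : Fin k → ℕ)

section Blocks

/-- Inside a block `R` with `Σ_R t = 0` (`d_R ≡ 1 (4)`): if `d_{R∖T} ≡ 1 (8)` then `Σ_T t = 0`.
[cite: Smith2016CongruentDensity, §2.2 (chunk p0010 L4–L8: the blocks S with d ≡ 1 (4))] -/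
theorem sum_addLegendreSym_neg_one_eq_zero_of_sdiff (hp : ∀ i, (p i).Prime) (hodd : ∀ i, Odd (p i))
    {R T : Finset (Fin k)} (hTR : T ⊆ R) (hR : ∑ i ∈ R, addLegendreSym (-1) (p i) = 0)
    (h8 : (∏ i ∈ R \ T, p i) % 8 = 1) : ∑ i ∈ T, addLegendreSym (-1) (p i) = 0 := by
  have hsplit : ∑ i ∈ R \ T, addLegendreSym (-1) (p i) + ∑ i ∈ T, addLegendreSym (-1) (p i) =
      ∑ i ∈ R, addLegendreSym (-1) (p i) := sum_sdiff hTR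
  rw [sum_addLegendreSym_neg_one_block_eq p hp hodd (R \ T), if_pos (by omega), zero_add] at hsplit
  rw [hsplit, hR]

/-- **Smith's lemma on a sub-block**: for `R` with `Σ_R t = 0` and `T ⊆ R`,
`setExp((t+z)·q_z)(T) · setExp(fwt a z z z)(R∖T) = [d_T ≡ 1 (4)] g(2 d_T) · ℒ(d_{R∖T})` in `𝔽₂` — both sides vanish
unless `d_{R∖T} ≡ 1 (8)`, and then `Σ_T t = 0` and `det P(A,t,z)[T] = det(A^T + D_z) = g(2d_T)`.
[cite: Smith2016CongruentDensity, §2.2 (chunk p0010 L1–L8: "det M₂(A, y, z) = Σ_S det P(A, y, z)[S] · det M₁(A, z)[S′] … det P[S] = g(2d)")] -/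
theorem markWeight_mul_rowOne_block_eq (hp : ∀ i, (p i).Prime) (hodd : ∀ i, Odd (p i))
    (hinj : Function.Injective p) {R T : Finset (Fin k)} (hTR : T ⊆ R)
    (hR : ∑ i ∈ R, addLegendreSym (-1) (p i) = 0) :
    setExp (fun C => (∑ i ∈ C, (addLegendreSym (-1) (p i) + addLegendreSym 2 (p i))) *
          qwt (fun i j => legendreMatrix p i j) (fun i => addLegendreSym 2 (p i)) C) T *
        setExp (fwt (fun i j => legendreMatrix p i j) (fun i => addLegendreSym 2 (p i))
          (fun i => addLegendreSym 2 (p i)) (fun i => addLegendreSym 2 (p i))) (R \ T) =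
      (if (∏ i ∈ T, p i) % 4 = 1 then ((genusClassNumber (GenusField (2 * ∏ i ∈ T, p i)) : ℕ) : ZMod 2)
        else 0) *
        ∑ D ∈ decompositions (∏ i ∈ R \ T, p i), ∏ d ∈ D,
          (if d % 8 = 1 then ((genusClassNumber (GenusField d) : ℕ) : ZMod 2) else 0) := by
  rw [setExp_fwt_legendre_eq_sum_decompositions p hp hodd hinj (R \ T)]
  by_cases h8 : (∏ i ∈ R \ T, p i) % 8 = 1
  · have hT := sum_addLegendreSym_neg_one_eq_zero_of_sdiff p hp hodd hTR hR h8
    have hT4 : (∏ i ∈ T, p i) % 4 = 1 := by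
      have h := sum_addLegendreSym_neg_one_block_eq p hp hodd T
      rw [hT] at h
      by_contra h4
      rw [if_neg h4] at h
      exact zero_ne_one h
    rw [setExp_markWeight_eq_genusWeight_two p hp hodd hinj T hT, if_pos hT4]
  · rw [sum_decompositions_rowOne_eq_zero p h8, mul_zero, mul_zero]

/-- **Smith's `det M₂[R]` on a block `R` with `d_R ≡ 1 (4)`, in genus class numbers**:
`setExp(fwt a t z z)(R) = Σ_{T ⊆ R} [d_T ≡ 1 (4)] g(2 d_T) · ℒ(d_{R∖T})`, `ℒ(m) = Σ_{D ∈ decompositions m} ∏ [d ≡ 1 (8)] g(d)`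
(the indicator is implied: `ℒ(d_{R∖T}) ≠ 0` forces `d_{R∖T} ≡ 1 (8)`, hence `d_T ≡ d_R ≡ 1 (4)`).
[cite: Smith2016CongruentDensity, Thm. 2.2 row 2 / §2.2 (chunk p0010 L1–L8), applied to the sub-block A_Rows[R, R]] -/
theorem setExp_fwt_mark_block_eq (hp : ∀ i, (p i).Prime) (hodd : ∀ i, Odd (p i))
    (hinj : Function.Injective p) {R : Finset (Fin k)} (hR : ∑ i ∈ R, addLegendreSym (-1) (p i) = 0) :
    setExp (fwt (fun i j => legendreMatrix p i j) (fun i => addLegendreSym (-1) (p i))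
        (fun i => addLegendreSym 2 (p i)) (fun i => addLegendreSym 2 (p i))) R =
      ∑ T ∈ R.powerset,
        (if (∏ i ∈ T, p i) % 4 = 1 then ((genusClassNumber (GenusField (2 * ∏ i ∈ T, p i)) : ℕ) : ZMod 2)
          else 0) *
        ∑ D ∈ decompositions (∏ i ∈ R \ T, p i), ∏ d ∈ D,
          (if d % 8 = 1 then ((genusClassNumber (GenusField d) : ℕ) : ZMod 2) else 0) := by
  rw [fwt_mark_eq_add, setExp_add]
  refine sum_congr rfl fun T hT => ?_
  rw [mem_powerset] at hT
  exact markWeight_mul_rowOne_block_eq p hp hodd hinj hT hR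

/-- The row-1 decomposition sum `ℒ(d_R)` of a block with `Σ_R t = 1` (`d_R ≡ 3 (4)`) vanishes.
[cite: Smith2016CongruentDensity, §2 Definition of ℒ ("Otherwise, ℒ(n) = 0")] -/
theorem sum_decompositions_rowOne_eq_zero_of_sum_neg_one (hp : ∀ i, (p i).Prime) (hodd : ∀ i, Odd (p i))
    {R : Finset (Fin k)} (hR : ∑ i ∈ R, addLegendreSym (-1) (p i) = 1) :
    ∑ D ∈ decompositions (∏ i ∈ R, p i), ∏ d ∈ D,
        (if d % 8 = 1 then ((genusClassNumber (GenusField d) : ℕ) : ZMod 2) else 0) = 0 := by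
  refine sum_decompositions_rowOne_eq_zero p fun h8 => ?_
  rw [sum_addLegendreSym_neg_one_block_eq p hp hodd R, if_pos (by omega)] at hR
  exact zero_ne_one hR

end Blocks

section PointedMark

/-- **The pointing identity for the mark weight** (the heart of Smith's `|T| = det(A + D_z)`): for a block `S`
with `Σ_S t = 1`, `Σ_{B ⊆ S} (Σ_B t) q_z(A^B) · setExp((t+z)q_z)(S∖B) = g(2 d_S)` in `𝔽₂` — for `Σ_B t = 1`
the complement has `Σ t = 0`, so Smith's lemma gives `setExp((t+z)q_z)(S∖B) = g(2d_{S∖B}) = det(A^{S∖B} + D_z) =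
setExp(q_z)(S∖B)`; the pointing lemma `Σ_B (Σ_B t) q_z(B) setExp(q_z)(S∖B) = (Σ_S t) setExp(q_z)(S)` and
`setExp(q_z)(S) = det(A^S + D_z) = g(2d_S)` finish.
[cite: Smith2016CongruentDensity, §2.2 (source cnc2.tex l. 96–107: the matrix T(A, y, z) and "this determinant is nonzero iff … det(A + D_z) ≠ 0")] -/
theorem sum_pointedMark_block_eq (hp : ∀ i, (p i).Prime) (hodd : ∀ i, Odd (p i))
    (hinj : Function.Injective p) {S : Finset (Fin k)} (hS : ∑ i ∈ S, addLegendreSym (-1) (p i) = 1) :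
    ∑ B ∈ S.powerset, (∑ i ∈ B, addLegendreSym (-1) (p i)) *
        qwt (fun i j => legendreMatrix p i j) (fun i => addLegendreSym 2 (p i)) B *
        setExp (fun C => (∑ i ∈ C, (addLegendreSym (-1) (p i) + addLegendreSym 2 (p i))) *
          qwt (fun i j => legendreMatrix p i j) (fun i => addLegendreSym 2 (p i)) C) (S \ B) =
      ((genusClassNumber (GenusField (2 * ∏ i ∈ S, p i)) : ℕ) : ZMod 2) := by
  have h01 : ∀ x : ZMod 2, x = 0 ∨ x = 1 := by decide
  -- replace Smith's mark weight on `S ∖ B` by the plain forest weight `setExp(q_z)`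
  have hterm : ∀ B ∈ S.powerset, (∑ i ∈ B, addLegendreSym (-1) (p i)) *
      qwt (fun i j => legendreMatrix p i j) (fun i => addLegendreSym 2 (p i)) B *
      setExp (fun C => (∑ i ∈ C, (addLegendreSym (-1) (p i) + addLegendreSym 2 (p i))) *
        qwt (fun i j => legendreMatrix p i j) (fun i => addLegendreSym 2 (p i)) C) (S \ B) =
      (∑ i ∈ B, addLegendreSym (-1) (p i)) *
        (qwt (fun i j => legendreMatrix p i j) (fun i => addLegendreSym 2 (p i)) B *
          setExp (qwt (fun i j => legendreMatrix p i j) (fun i => addLegendreSym 2 (p i))) (S \ B)) := by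
    intro B hB
    rw [mem_powerset] at hB
    rcases h01 (∑ i ∈ B, addLegendreSym (-1) (p i)) with h0 | h1
    · rw [h0, zero_mul, zero_mul, zero_mul]
    · have hSB : ∑ i ∈ S \ B, addLegendreSym (-1) (p i) = 0 := by
        have hsplit : ∑ i ∈ S \ B, addLegendreSym (-1) (p i) + ∑ i ∈ B, addLegendreSym (-1) (p i) =
            ∑ i ∈ S, addLegendreSym (-1) (p i) := sum_sdiff hB
        rw [h1, hS] at hsplit
        have h11 : ∀ x : ZMod 2, x + 1 = 1 → x = 0 := by decide
        exact h11 _ hsplit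
      rw [setExp_markWeight_eq_genusWeight_two p hp hodd hinj (S \ B) hSB,
        ← det_lap_legendre_eq_genusWeight_two p hp hodd hinj (S \ B), det_lap_eq_setExp, mul_assoc]
  rw [sum_congr rfl hterm, setExp_point, hS, one_mul, ← det_lap_eq_setExp,
    det_lap_legendre_eq_genusWeight_two p hp hodd hinj S]

/-- **The `d ≡ 3 (8)` part of `det M₆` is a pure even sum** (every `k`, `∏ pᵢ ≡ 3 (4)`):
`Σ_B (Σ_B t) q_z(A^B) · e₂([k]∖B) = Σ_{S : d_S ≡ 3 (4)} g(2d_S) · ℒ(d_{[k]∖S})` in `𝔽₂`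
(`e₂ = setExp(fwt a t z z)`; the pointed weight `(Σ_B t) q_z(A^B)` is `[d_B ≡ 3 (8)] g(d_B)`).  This is Smith's
`Σ_S det T(A,y,z)[S] det M₁[S′] = Σ_S det(A_Rows[S,S] + D_z) det M₁[S′]`, "the first part of the sum in case 6".
[cite: Smith2016CongruentDensity, §2.2 (source cnc2.tex l. 91–110)] -/
theorem pointedMark_eq_sum_genusWeight_two (hp : ∀ i, (p i).Prime) (hodd : ∀ i, Odd (p i))
    (hinj : Function.Injective p) (h4 : (∏ i, p i) % 4 = 3) :
    ∑ B ∈ (univ : Finset (Fin k)).powerset, (∑ i ∈ B, addLegendreSym (-1) (p i)) *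
        qwt (fun i j => legendreMatrix p i j) (fun i => addLegendreSym 2 (p i)) B *
          setExp (fwt (fun i j => legendreMatrix p i j) (fun i => addLegendreSym (-1) (p i))
            (fun i => addLegendreSym 2 (p i)) (fun i => addLegendreSym 2 (p i))) (univ \ B) =
      ∑ S ∈ (univ : Finset (Fin k)).powerset,
        (if (∏ i ∈ S, p i) % 4 = 1 then 0
          else ((genusClassNumber (GenusField (2 * ∏ i ∈ S, p i)) : ℕ) : ZMod 2)) *
        ∑ D ∈ decompositions (∏ i ∈ univ \ S, p i), ∏ d ∈ D,
          (if d % 8 = 1 then ((genusClassNumber (GenusField d) : ℕ) : ZMod 2) else 0) := by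
  have h01 : ∀ x : ZMod 2, x = 0 ∨ x = 1 := by decide
  have htot : ∑ i ∈ (univ : Finset (Fin k)), addLegendreSym (-1) (p i) = 1 := by
    rw [sum_addLegendreSym_neg_one_block_eq p hp hodd univ, if_neg (by omega)]
  -- expand `e₂` along Smith's decomposition and swap to `S = B ∪ T`
  have hexp : ∀ B ∈ (univ : Finset (Fin k)).powerset,
      (∑ i ∈ B, addLegendreSym (-1) (p i)) *
        qwt (fun i j => legendreMatrix p i j) (fun i => addLegendreSym 2 (p i)) B *
          setExp (fwt (fun i j => legendreMatrix p i j) (fun i => addLegendreSym (-1) (p i))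
            (fun i => addLegendreSym 2 (p i)) (fun i => addLegendreSym 2 (p i))) (univ \ B) =
      ∑ T ∈ (univ \ B).powerset, (∑ i ∈ B, addLegendreSym (-1) (p i)) *
        qwt (fun i j => legendreMatrix p i j) (fun i => addLegendreSym 2 (p i)) B *
        setExp (fun C => (∑ i ∈ C, (addLegendreSym (-1) (p i) + addLegendreSym 2 (p i))) *
          qwt (fun i j => legendreMatrix p i j) (fun i => addLegendreSym 2 (p i)) C) ((B ∪ T) \ B) *
        setExp (fwt (fun i j => legendreMatrix p i j) (fun i => addLegendreSym 2 (p i))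
          (fun i => addLegendreSym 2 (p i)) (fun i => addLegendreSym 2 (p i))) (univ \ (B ∪ T)) := by
    intro B hB
    rw [fwt_mark_eq_add, setExp_add, mul_sum]
    refine sum_congr rfl fun T hT => ?_
    rw [mem_powerset] at hT
    have hdisj : Disjoint B T := disjoint_of_subset_right hT disjoint_sdiff
    rw [union_sdiff_cancel_left hdisj, sdiff_sdiff_left, sup_eq_union]
    ring
  have key := sum_powerset_sum_powerset_sub (univ : Finset (Fin k)) (fun B E =>
    (∑ i ∈ B, addLegendreSym (-1) (p i)) *
      qwt (fun i j => legendreMatrix p i j) (fun i => addLegendreSym 2 (p i)) B *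
      setExp (fun C => (∑ i ∈ C, (addLegendreSym (-1) (p i) + addLegendreSym 2 (p i))) *
        qwt (fun i j => legendreMatrix p i j) (fun i => addLegendreSym 2 (p i)) C) (E \ B) *
      setExp (fwt (fun i j => legendreMatrix p i j) (fun i => addLegendreSym 2 (p i))
        (fun i => addLegendreSym 2 (p i)) (fun i => addLegendreSym 2 (p i))) (univ \ E))
  rw [sum_congr rfl hexp, ← key]
  refine sum_congr rfl fun S _ => ?_
  have hrow : setExp (fwt (fun i j => legendreMatrix p i j) (fun i => addLegendreSym 2 (p i))
      (fun i => addLegendreSym 2 (p i)) (fun i => addLegendreSym 2 (p i))) (univ \ S) =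
      ∑ D ∈ decompositions (∏ i ∈ univ \ S, p i), ∏ d ∈ D,
        (if d % 8 = 1 then ((genusClassNumber (GenusField d) : ℕ) : ZMod 2) else 0) :=
    setExp_fwt_legendre_eq_sum_decompositions p hp hodd hinj (univ \ S)
  have hsplit : ∑ i ∈ univ \ S, addLegendreSym (-1) (p i) + ∑ i ∈ S, addLegendreSym (-1) (p i) = 1 := by
    rw [sum_sdiff (subset_univ S), htot]
  have hS4 := sum_addLegendreSym_neg_one_block_eq p hp hodd S
  rw [← sum_mul, hrow]
  rcases h01 (∑ i ∈ S, addLegendreSym (-1) (p i)) with h0 | h1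
  · -- `d_S ≡ 1 (4)`: the complement has `Σ t = 1`, so `ℒ(d_{[k]∖S}) = 0`
    rw [h0, add_zero] at hsplit
    rw [sum_decompositions_rowOne_eq_zero_of_sum_neg_one p hp hodd hsplit, mul_zero, mul_zero]
  · -- `d_S ≡ 3 (4)`: the pointing identity
    rw [sum_pointedMark_block_eq p hp hodd hinj h1]
    rw [h1] at hS4
    have h3 : ¬ (∏ i ∈ S, p i) % 4 = 1 := fun h => by rw [if_pos h] at hS4; exact one_ne_zero hS4
    rw [if_neg h3]

end PointedMark

section Assembly

/-- The re-rooted pointed weight with the empty block allowed: `(Σ_B t) q_t(A^B) = [d_B ≢ 1 (4)] g(d_B)`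
(`d_∅ = 1`). [cite: Smith2016CongruentDensity, §2 Table 1 row n ≡ 3 (4)] -/
theorem pointedWeight_neg_one_legendre_eq_genusWeight' (hp : ∀ i, (p i).Prime) (hodd : ∀ i, Odd (p i))
    (hinj : Function.Injective p) (B : Finset (Fin k)) :
    (∑ i ∈ B, addLegendreSym (-1) (p i)) *
        qwt (fun i j => legendreMatrix p i j) (fun i => addLegendreSym (-1) (p i)) B =
      if (∏ i ∈ B, p i) % 4 = 1 then 0
      else ((genusClassNumber (GenusField (∏ i ∈ B, p i)) : ℕ) : ZMod 2) := by
  rcases B.eq_empty_or_nonempty with rfl | hB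
  · rw [sum_empty, zero_mul, prod_empty, if_pos (by norm_num)]
  · exact pointedWeight_neg_one_legendre_eq_genusWeight p hp hodd hinj hB

/-- The row-3 pointed weight with the empty block allowed: `(Σ_B t) q_z(A^B) = [d_B ≡ 3 (8)] g(d_B)`.
[cite: Smith2016CongruentDensity, §2.2 (chunk p0008 L42–L50)] -/
theorem pointedWeight_legendre_eq_genusWeight' (hp : ∀ i, (p i).Prime) (hodd : ∀ i, Odd (p i))
    (hinj : Function.Injective p) (B : Finset (Fin k)) :
    (∑ i ∈ B, addLegendreSym (-1) (p i)) *
        qwt (fun i j => legendreMatrix p i j) (fun i => addLegendreSym 2 (p i)) B =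
      if (∏ i ∈ B, p i) % 8 = 3 then
        ((genusClassNumber (GenusField (∏ i ∈ B, p i)) : ℕ) : ZMod 2) else 0 := by
  rcases B.eq_empty_or_nonempty with rfl | hB
  · rw [sum_empty, zero_mul, prod_empty, if_neg (by norm_num)]
  · exact pointedWeight_legendre_eq_genusWeight p hp hodd hinj hB

/-- Splitting `[d ≢ 1 (4)] g(d) = [d ≡ 3 (8)] g(d) + [d ≡ 7 (8)] g(d)` for an odd block product.
[cite: Smith2016CongruentDensity, §2.2 (source cnc2.tex l. 84–89: the O-term with d ≡ 7 (8); l. 100–110: the T-term)] -/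
theorem genusWeight_three_mod_four_split (hp : ∀ i, (p i).Prime) (hodd : ∀ i, Odd (p i))
    (B : Finset (Fin k)) :
    (if (∏ i ∈ B, p i) % 4 = 1 then (0 : ZMod 2)
      else ((genusClassNumber (GenusField (∏ i ∈ B, p i)) : ℕ) : ZMod 2)) =
      (if (∏ i ∈ B, p i) % 8 = 3 then ((genusClassNumber (GenusField (∏ i ∈ B, p i)) : ℕ) : ZMod 2) else 0) +
      (if (∏ i ∈ B, p i) % 8 = 7 then ((genusClassNumber (GenusField (∏ i ∈ B, p i)) : ℕ) : ZMod 2) else 0) := by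
  have h2 := blockProd_mod_two p hp hodd B
  by_cases h1 : (∏ i ∈ B, p i) % 4 = 1
  · rw [if_pos h1, if_neg (by omega), if_neg (by omega), add_zero]
  · by_cases h3 : (∏ i ∈ B, p i) % 8 = 3
    · rw [if_neg h1, if_pos h3, if_neg (by omega), add_zero]
    · rw [if_neg h1, if_neg h3, if_pos (by omega), zero_add]

/-- **`det M₆` in genus class numbers, for every `k`** (Smith 2016, Thm. 2.2 row 6, both sides evaluated):
for `n = 2p₁⋯p_k` with `∏ pᵢ ≡ 3 (mod 4)` (`n ≡ 6 (mod 8)`), with `t = ((−1/pᵢ)₊)`, `z = ((2/pᵢ)₊)`,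
`M₂ = [[A + Aᵀ + D_t + D_z, Aᵀ],[A, D_z]]`, `g(d) = #2Cl(ℚ(√−d))` and
`ℒ(m) = Σ_{D ∈ decompositions m} ∏_{d ∈ D} [d ≡ 1 (8)] g(d)`:
`(t;t)ᵀ adj(M₂) (t;t) = Σ_{S ⊆ [k], d_S ≡ 3 (4)} g(2d_S)·ℒ(d_{[k]∖S}) + Σ_{B ⊆ [k], d_B ≡ 7 (8)} g(d_B)·Σ_{T ⊆ [k]∖B, d_T ≡ 1 (4)} g(2d_T)·ℒ(d_{[k]∖B∖T})`
— Smith's `ℒ₆(n) = Σ_{d | n, d ≡ n (16)} g(d)ℒ(n/d) + Σ_{d₀d₁ | n, d₀ ≡ 7n (16), d₁ ≡ 7 (8)} g(d₀)g(d₁)ℒ(n/d₀d₁)`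
written over index blocks (the congruences mod `16` are implied by `ℒ(m) = 0` for `m ≢ 1 (8)`).
[cite: Smith2016CongruentDensity, Thm. 2.2 row 6 / Table 2 (source cnc.tex l. 100–107) and §2.2 (cnc2.tex l. 73–110)] -/
theorem border_adjugate_six_eq_sum_genusWeight (hp : ∀ i, (p i).Prime) (hodd : ∀ i, Odd (p i))
    (hinj : Function.Injective p) (h4 : (∏ i, p i) % 4 = 3) :
    Sum.elim (fun i => addLegendreSym (-1) (p i)) (fun i => addLegendreSym (-1) (p i)) ⬝ᵥ
        ((fromBlocks (legendreMatrix p + (legendreMatrix p)ᵀ + (legendreDiagonal p (-1) + legendreDiagonal p 2))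
            (legendreMatrix p)ᵀ (legendreMatrix p) (legendreDiagonal p 2)).adjugate *ᵥ
          Sum.elim (fun i => addLegendreSym (-1) (p i)) (fun i => addLegendreSym (-1) (p i))) =
      ∑ S ∈ (univ : Finset (Fin k)).powerset,
        (if (∏ i ∈ S, p i) % 4 = 1 then 0
          else ((genusClassNumber (GenusField (2 * ∏ i ∈ S, p i)) : ℕ) : ZMod 2)) *
        ∑ D ∈ decompositions (∏ i ∈ univ \ S, p i), ∏ d ∈ D,
          (if d % 8 = 1 then ((genusClassNumber (GenusField d) : ℕ) : ZMod 2) else 0) +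
      ∑ B ∈ (univ : Finset (Fin k)).powerset,
        (if (∏ i ∈ B, p i) % 8 = 7 then ((genusClassNumber (GenusField (∏ i ∈ B, p i)) : ℕ) : ZMod 2) else 0) *
        ∑ T ∈ (univ \ B).powerset,
          (if (∏ i ∈ T, p i) % 4 = 1 then ((genusClassNumber (GenusField (2 * ∏ i ∈ T, p i)) : ℕ) : ZMod 2)
            else 0) *
          ∑ D ∈ decompositions (∏ i ∈ (univ \ B) \ T, p i), ∏ d ∈ D,
            (if d % 8 = 1 then ((genusClassNumber (GenusField d) : ℕ) : ZMod 2) else 0) := by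
  have htot : ∑ i ∈ (univ : Finset (Fin k)), addLegendreSym (-1) (p i) = 1 := by
    rw [sum_addLegendreSym_neg_one_block_eq p hp hodd univ, if_neg (by omega)]
  have h2 := fun B => blockProd_mod_two p hp hodd B
  -- the pointed weight, split into its `d ≡ 3 (8)` and `d ≡ 7 (8)` parts
  have hsummand : ∀ B ∈ (univ : Finset (Fin k)).powerset,
      (∑ i ∈ B, addLegendreSym (-1) (p i)) *
        qwt (fun i j => legendreMatrix p i j) (fun i => addLegendreSym (-1) (p i)) B *
          setExp (fwt (fun i j => legendreMatrix p i j) (fun i => addLegendreSym (-1) (p i))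
            (fun i => addLegendreSym 2 (p i)) (fun i => addLegendreSym 2 (p i))) (univ \ B) =
      (∑ i ∈ B, addLegendreSym (-1) (p i)) *
        qwt (fun i j => legendreMatrix p i j) (fun i => addLegendreSym 2 (p i)) B *
          setExp (fwt (fun i j => legendreMatrix p i j) (fun i => addLegendreSym (-1) (p i))
            (fun i => addLegendreSym 2 (p i)) (fun i => addLegendreSym 2 (p i))) (univ \ B) +
      (if (∏ i ∈ B, p i) % 8 = 7 then ((genusClassNumber (GenusField (∏ i ∈ B, p i)) : ℕ) : ZMod 2) else 0) *
        ∑ T ∈ (univ \ B).powerset,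
          (if (∏ i ∈ T, p i) % 4 = 1 then ((genusClassNumber (GenusField (2 * ∏ i ∈ T, p i)) : ℕ) : ZMod 2)
            else 0) *
          ∑ D ∈ decompositions (∏ i ∈ (univ \ B) \ T, p i), ∏ d ∈ D,
            (if d % 8 = 1 then ((genusClassNumber (GenusField d) : ℕ) : ZMod 2) else 0) := by
    intro B _
    rw [pointedWeight_neg_one_legendre_eq_genusWeight' p hp hodd hinj B,
      genusWeight_three_mod_four_split p hp hodd B, add_mul,
      ← pointedWeight_legendre_eq_genusWeight' p hp hodd hinj B]
    congr 1
    by_cases h7 : (∏ i ∈ B, p i) % 8 = 7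
    · -- `d_B ≡ 7 (8)`: the complement has `Σ t = 0`, Smith's row-2 expansion applies to it
      have hB1 : ∑ i ∈ B, addLegendreSym (-1) (p i) = 1 := by
        rw [sum_addLegendreSym_neg_one_block_eq p hp hodd B, if_neg (by omega)]
      have hR : ∑ i ∈ univ \ B, addLegendreSym (-1) (p i) = 0 := by
        have hsplit : ∑ i ∈ univ \ B, addLegendreSym (-1) (p i) + ∑ i ∈ B, addLegendreSym (-1) (p i) = 1 := by
          rw [sum_sdiff (subset_univ B), htot]
        rw [hB1] at hsplit
        have h11 : ∀ x : ZMod 2, x + 1 = 1 → x = 0 := by decide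
        exact h11 _ hsplit
      rw [setExp_fwt_mark_block_eq p hp hodd hinj hR]
    · rw [if_neg h7, zero_mul, zero_mul]
  rw [border_adjugate_six_eq_sum_powerset, sum_congr rfl hsummand, sum_add_distrib,
    pointedMark_eq_sum_genusWeight_two p hp hodd hinj h4]

end Assembly

end Literature.NumberTheory.EllipticCurves.Smith2016
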